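import Summits.BirchSwinnertonDyer.Rank1Residual.P2.CongruentNumberSilentEvenFiveThetaDescent
import Summits.BirchSwinnertonDyer.Rank1Residual.P2.CongruentNumberSilentEvenFiveProofBHook
import HarnessLib

/-!
# Cell «bsd-monsky» (prover-B): route B's kernel THROUGH THE DOORS — `thetaGenusPointDatum` (+ GZK or Cor 5.15, RR, h515)
# ⟹ C-P2-1 (both forms) on `𝒮⁻` and `BSD(E_{2pq}, 2)` on the whole even-five family — nothing asserted

HONEST FRAMING (cell `bsd-monsky`, run/shared/lean/pub/bsd-monsky/; README §1): glue only; every theorem is CONDITIONAL on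
the named hypotheses. `P2/CongruentNumberSilentEvenFiveThetaDescent.lean` proves THEOREM B in the kernel from route B's
display (`theoremB_of_thetaGenusPointDatum (hΘ) (hGZK)`, and the GZK-free `…_of_cor515 (hΘ) (h515)`); the landed hook
`P2/CongruentNumberSilentEvenFiveProofBHook.lean` turns Theorem B (hypothesis `hThmB`) + Rédei into C-P2-1. This file
composes the two: `congruentSilentEvenFiveOrdTwo_of_thetaGenusPointDatum (hΘ) (hGZK) (hR)` (sharper form, no `h515`),
`…BSDTwo_of_thetaGenusPointDatum (hΘ) (hGZK) (hR) (h515)`, the GZK-FREE `…BSDTwo_of_thetaGenusPointDatum_of_cor515 (hΘ) (hR) (h515)`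
(route B's enclosure from THREE named inputs; NB on this path the rank-one input comes from Monsky 1990, so PROOF-B's
independence from Monsky's paper holds on the GZK path only), and `BSD(E_{2pq}, 2)` for both symbols with the `𝒮⁺`
theorem's binders. Nothing booked; no mark moved.

References: HOME/proof/PROOF-B.md §9–§11; [TianYuanZhang2017] Thm. 1.2, Thm. 3.5, §1 (1.1); [Monsky1990MockHeegner]
Cor. 5.15 (2′); [LiMa2008] Thm. 0.4; [Miller2011LMS] Def. 1.1.
-/

noncomputable section

open scoped Classical

open WeierstrassCurve NumberField Literature.NumberTheory.EllipticCurves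
  Literature.NumberTheory.EllipticCurves.Rank1Residual
  Literature.NumberTheory.EllipticCurves.Rank1Residual.Typed
  Literature.NumberTheory.EllipticCurves.Monsky1990
  Literature.NumberTheory.EllipticCurves.TianYuanZhang2017
  Literature.NumberTheory.QuadraticFields.RedeiReichardt

set_option autoImplicit false

namespace Summit.BirchSwinnertonDyer.Rank1Residual.P2

open ThetaDescent Conjectures

/-! ## §6 Compositions: the display ⟹ THEOREM B in tree currency ⟹ C-P2-1 on `𝒮⁻` (through the landed hook) -/

/-- **Route B in the kernel ⟹ C-P2-1, sharper form, on `𝒮⁻`** — modulo the ONE display `thetaGenusPointDatum`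
(kernel debt `K_B`), GZK and Rédei–Reichardt (for `g(2pq)` odd on `(p/q) = −1`, the hook's
`odd_scriptL_sMinus_of_theoremB`); no `h515`. [cite: TianYuanZhang2017, §1 ((1.1)), Thm. 3.5]
[cite: Miller2011LMS, Def. 1.1 (arXiv:1010.2431 p. 3)] -/
theorem congruentSilentEvenFiveOrdTwo_of_thetaGenusPointDatum
    (hΘ : ∀ p q : ℕ, p.Prime → q.Prime → p % 8 = 5 → q % 4 = 3 → thetaGenusPointDatum p q)
    (hGZK : rank_eq_analyticRank_of_analyticRank_le_one) (hR : redeiReichardt_fourTwoCard_classGroup) :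
    CongruentSilentEvenFiveOrdTwo :=
  congruentSilentEvenFiveOrdTwo_of_odd_scriptL
    (odd_scriptL_sMinus_of_theoremB hR (theoremB_of_thetaGenusPointDatum hΘ hGZK))

/-- **Route B in the kernel ⟹ C-P2-1, observable form (`ord_{s=1} L(E_{2pq}, s) = 1 ∧ BSD(E_{2pq}, 2)` on `𝒮⁻`)**,
modulo `thetaGenusPointDatum`, GZK, Rédei–Reichardt and Monsky 1990 Cor 5.15 (`h515`, door D-CN-5). CONDITIONAL;
nothing asserted. [cite: Monsky1990MockHeegner, Cor. 5.15 (2′) (p. 66), Remark (3) (p. 67)]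
[cite: Miller2011LMS, Def. 1.1 (arXiv:1010.2431 p. 3)] -/
theorem congruentSilentEvenFiveBSDTwo_of_thetaGenusPointDatum
    (hΘ : ∀ p q : ℕ, p.Prime → q.Prime → p % 8 = 5 → q % 4 = 3 → thetaGenusPointDatum p q)
    (hGZK : rank_eq_analyticRank_of_analyticRank_le_one) (hR : redeiReichardt_fourTwoCard_classGroup)
    (h515 : cor515_rank_eq_one_and_card_selmerGroup_two) : CongruentSilentEvenFiveBSDTwo :=
  congruentSilentEvenFiveBSDTwo_of_theoremB hR h515 (theoremB_of_thetaGenusPointDatum hΘ hGZK)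

/-- **Route B ⟹ C-P2-1 (observable form) on `𝒮⁻` from THREE named inputs, no GZK**: the display `thetaGenusPointDatum`,
Rédei–Reichardt (`hR`), Monsky 1990 Cor 5.15 (`h515`: rank one for (REP)'s generator AND the Selmer row of door D-CN-5).
The GZK-free fact set of route B. CONDITIONAL; nothing asserted. [cite: Monsky1990MockHeegner, Cor. 5.15 (2′) (p. 66), Remark (3) (p. 67)]
[cite: Miller2011LMS, Def. 1.1 (arXiv:1010.2431 p. 3)] -/
theorem congruentSilentEvenFiveBSDTwo_of_thetaGenusPointDatum_of_cor515
    (hΘ : ∀ p q : ℕ, p.Prime → q.Prime → p % 8 = 5 → q % 4 = 3 → thetaGenusPointDatum p q)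
    (hR : redeiReichardt_fourTwoCard_classGroup) (h515 : cor515_rank_eq_one_and_card_selmerGroup_two) :
    CongruentSilentEvenFiveBSDTwo :=
  congruentSilentEvenFiveBSDTwo_of_theoremB hR h515 (theoremB_of_thetaGenusPointDatum_of_cor515 hΘ h515)

/-- **`BSD(E_{2pq}, 2)` on the WHOLE even-five family, both symbols, with route B's kernel on `𝒮⁻`** (binders of the
landed `𝒮⁺` theorem + the display). CONDITIONAL; nothing asserted. [cite: TianYuanZhang2017, Thm. 1.2, Thm. 3.5 and §1 (1.1)]
[cite: Monsky1990MockHeegner, Cor. 5.15 (2′) (p. 66)] [cite: Miller2011LMS, Def. 1.1 (arXiv:1010.2431 p. 3)] -/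
theorem forall_bsdp_two_congruentNumberCurve_two_mul_five_mul_of_thetaGenusPointDatum
    (hTYZ : tyz_genusPointData) (hGZK : rank_eq_analyticRank_of_analyticRank_le_one)
    (hR : redeiReichardt_fourTwoCard_classGroup) (h515 : cor515_rank_eq_one_and_card_selmerGroup_two)
    (hΘ : ∀ p q : ℕ, p.Prime → q.Prime → p % 8 = 5 → q % 4 = 3 → thetaGenusPointDatum p q) :
    ∀ p q : ℕ, p.Prime → q.Prime → p % 8 = 5 → q % 4 = 3 →
      BSDp (congruentNumberCurve (2 * (p * q))) 2 :=
  forall_bsdp_two_congruentNumberCurve_two_mul_five_mul_of_theoremB hTYZ hGZK hR h515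
    (theoremB_of_thetaGenusPointDatum hΘ hGZK)

end Summit.BirchSwinnertonDyer.Rank1Residual.P2

end
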